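import Mathlib.LinearAlgebra.Matrix.SpecialLinearGroup
import Mathlib.LinearAlgebra.Matrix.GeneralLinearGroup.Defs
import Mathlib.RingTheory.Nullstellensatz
import Mathlib.RingTheory.KrullDimension.Basic
import Literature.Barriers.MatrixMultiplication.NormalizerBarrier
import HarnessLib

/-!
# Triple-product-property constructions in algebraic and Lie groups (Blasiak–Cohn–Grochow–Pratt–Umans 2023, §4)

Source: J. Blasiak, H. Cohn, J. A. Grochow, K. Pratt, C. Umans, *Matrix multiplication via matrix
groups*, ITCS 2023 (LIPIcs 251, 19:1–19:16), arXiv:2204.03826. Numbering is that of the arXiv text,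
§4 "Constructions in Lie groups" (Def. 4.1 – Rem. 4.11) — the section that the tree's barrier entries
`Literature.Barriers.MatrixMultiplication.QuasirandomBarrier` (§3.1: Thm. 3.2, Cor. 3.3–3.5) and
`Literature.Barriers.MatrixMultiplication.NormalizerBarrier` (§3.2: Thm. 3.6, Rem. 3.7, Cor. 3.8)
quote in their `evasions_known:` lines but do not state. This file types §4 (statements first,
D-0064: one file for the section); §2–§3 of the paper are already in the tree (Thm. 2.2 = the
Cohn–Umans inequality `CKSU2005_thm18`; §3 as above, all proved).

## Source item → Lean declaration → status

| BCGPU 2023, §4 | declaration | status |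
|---|---|---|
| Def. 2.1 (TPP with right quotient sets `Q(X) = {x x'⁻¹}`), for arbitrary subsets | `SetTripleProductProperty` | definition (the tree's `TripleProductProperty` is the `Finset` form: `setTripleProductProperty_coe_iff`) |
| Lemma 4.8, hypothesis ("`K`-triple product property") | `KTripleProductProperty` | definition; `K = {1}` is the subgroup TPP (`kTripleProductProperty_bot_iff`) |
| Def. 4.1 / Lemma 4.8, the bounding quotient `r(G) / ((Σ dim Hᵢ − 2 dim K)/3 − (dim G − r(G))/2)` | `lieExponentQuotient` | definition on the numerical data only — see "What is NOT typed" |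
| Prop. 4.3, final step (`(Σ dim Mᵢ)/3 ≤ dim G/2 ⇒` quotient `≥ 2`) | `two_le_lieExponentQuotient` | proved |
| remark after Prop. 4.3 and Prop. 4.4 (`Σ dim Mᵢ ≤ dim G ⇒` quotient `≥ 3`; abelian `G`: `= 3`) | `three_le_lieExponentQuotient`, `lieExponentQuotient_whole_group` | proved |
| Prop. 4.6, the inequality its proof establishes | `div_le_lieExponentQuotient` | proved |
| Thm. 4.7 (subvarieties of an algebraic group over an algebraically closed field with the TPP have `dim V₁ + dim V₂ + dim V₃ ≤ dim G`) | `BCGPU2023_thm47` | named fact (special case: closed subvarieties of a Zariski-closed subgroup `G ≤ GL_ι(k)`, i.e. of an affine algebraic group) |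
| Thm. 4.9, the claim its proof establishes (`SO(n,ℝ)^m`, upper unitriangular tuples, lower triangular tuples with `∏ᵢ B⁽ⁱ⁾ⱼⱼ = 1` satisfy the `K`-TPP in `SL(n,ℝ)^m`, `K` = `±1` diagonal tuples) | `BCGPU2023_thm49` | named fact, PROVED (`BCGPU2023_thm49_holds`, the printed column induction) |
| Thm. 4.9, the bound `3m(n−1)/(m(n−1)−n)` from the printed dimensions via Lemma 4.8 | `lieExponentQuotient_thm49` | proved (arithmetic identity) |
| Thm. 4.10 (three conjugates of `O(n,ℝ)` in `GL(n,ℝ)` satisfy the `K`-TPP, `K` = `±1` diagonal matrices) | `BCGPU2023_thm410` | named fact, PROVED (`BCGPU2023_thm410_holds`, with the printed witnesses `D₁ = diag(2^{-i})`, `D₂ = diag(2^{i})`) |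

## What is NOT typed, and why (recorded, not silently weakened)

* **Def. 4.1 (Lie exponent `ω(G)`), Question 4.2, Prop. 4.3 / 4.4 / 4.6 as statements about all Lie
  groups, Def. 4.5, Lemma 4.8 as an implication, Rem. 4.11.** `ω(G)` is an infimum over all triples
  of *submanifolds* of a Lie group `G` satisfying the TPP, normalised by the *rank* `r(G)` = real
  dimension of a Cartan subalgebra of `Lie(G)`. Mathlib (v4.32.0 pin) has `LieGroup` and
  `LieSubalgebra.IsCartanSubalgebra`, but no notion of embedded submanifold with a dimension, and no
  identification of the Lie algebra of a `LieGroup` (left-invariant derivations) with a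
  finite-dimensional real Lie algebra to which `LieAlgebra.rank` applies; the slice theorem used in
  Lemma 4.8 is likewise absent. We therefore type (i) the ALGEBRAIC content of the constructions —
  the `K`-triple product property of explicit matrix subgroups (Thms. 4.9, 4.10), which is all that
  their printed proofs establish — and (ii) the quotient of Def. 4.1 / Lemma 4.8 as a function of the
  six numbers `(r(G), dim G, dim H₁, dim H₂, dim H₃, dim K)`, with the printed dimension bookkeeping
  of Thm. 4.9 and the final inequalities of Props. 4.3, 4.4, 4.6 PROVED on that data. The sentence
  "the Lie exponent of `SL(n,ℝ)^m` is at most `3m(n−1)/(m(n−1)−n)`" is thus represented by the pair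
  (`BCGPU2023_thm49`, `lieExponentQuotient_thm49`) together with the printed values
  `dim SL(n,ℝ)^m = m(n²−1)`, `r = m(n−1)`, `dim SO(n)^m = dim UT(n)^m = mn(n−1)/2`,
  `dim H₃ = m(n(n+1)/2 − 1) − n`, `dim K = 0` [cite: BlasiakCohnGrochowPrattUmans2023, Thm. 4.9 (proof)].
  TODO(general form): `def lieExponent (G) : ℝ` once submanifold dimension and `Lie(G)` are available.
* **Thm. 4.7** is typed for closed subvarieties `Vᵢ` of a Zariski-closed subgroup `G ≤ GL_ι(k)` (every
  affine algebraic group is of this form); the printed theorem allows arbitrary algebraic groups and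
  (locally closed) subvarieties. TODO(general form): non-affine algebraic groups.
* **Cor. 3.4** (no TPP construction in a finite group of Lie type beats `2 + ε`): needs "finite group of
  Lie type" and the Landazuri–Seitz / Fulman–Guralnick bounds; recorded (with its proof sketch) in
  `QuasirandomBarrier`'s `scope_caveats:` (b), not restated here.
* Rem. 4.11 (the `GL(n,ℂ)`/`U(n)` and `GL(n,ℍ)`/`Sp(n)` variants of Thm. 4.10): the COMPLEX case is typed
  and PROVED in the sequel `LieGroupTPPConstructionsUnitary.lean` (`BCGPU2023_rem411_unitary`,
  `BCGPU2023_rem411_unitary_holds`; 2026-08-27); the quaternionic case remains prose only (no `GL(n,ℍ)`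
  conjugate-transpose calculus in the tree).

WHAT THIS IS NOT: nothing in §4 is a bound on `ω`; Question 4.2 (is `ω ≤ ω(G)` for every Lie group
`G`?) is open, and "the best upper bound we know on the Lie exponent is `3`"
[cite: BlasiakCohnGrochowPrattUmans2023, §4 (before Prop. 4.4) and §5].
-/

noncomputable section

open scoped BigOperators Matrix

namespace Literature.Computability.AlgebraicComplexity

universe u

/-! ## The triple product property for arbitrary subsets, and the `K`-triple product property -/

section TPP

variable {G : Type u} [Group G]

/-- **Triple product property** of three arbitrary subsets `S, T, U` of a group `G` (BCGPU 2023,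
Def. 2.1 = Cohn–Umans 2003, Def. 2.1): with `Q(X) = {x x'⁻¹ : x, x' ∈ X}`, "for all `s ∈ Q(S)`,
`t ∈ Q(T)`, and `u ∈ Q(U)`, `stu = 1 ⟹ s = t = u = 1`", i.e. `s s'⁻¹ (t t'⁻¹) (u u'⁻¹) = 1` forces
`s = s'`, `t = t'`, `u = u'`. This is the tree's `Literature.Combinatorics.Additive.TripleProductProperty`
verbatim with `Finset` replaced by `Set` (needed for infinite subsets: subvarieties, Lie subgroups);
the two agree on finite sets (`setTripleProductProperty_coe_iff`).
[cite: BlasiakCohnGrochowPrattUmans2023, Def. 2.1] -/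
def SetTripleProductProperty (S T U : Set G) : Prop :=
  ∀ s ∈ S, ∀ s' ∈ S, ∀ t ∈ T, ∀ t' ∈ T, ∀ u ∈ U, ∀ u' ∈ U,
    s * s'⁻¹ * (t * t'⁻¹) * (u * u'⁻¹) = 1 → s = s' ∧ t = t' ∧ u = u'

/-- On finite sets the `Set` form is literally the tree's `TripleProductProperty` (the printed
Def. 2.1 read for finite subsets). [cite: BlasiakCohnGrochowPrattUmans2023, Def. 2.1] -/
theorem setTripleProductProperty_coe_iff (S T U : Finset G) :
    SetTripleProductProperty (S : Set G) T U ↔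
      Literature.Combinatorics.Additive.TripleProductProperty S T U := by
  simp only [SetTripleProductProperty, Finset.mem_coe,
    Literature.Combinatorics.Additive.TripleProductProperty]

/-- Subsets of a triple with the triple product property again have it (immediate from Def. 2.1,
a universal statement over the three sets). [cite: BlasiakCohnGrochowPrattUmans2023, Def. 2.1] -/
theorem SetTripleProductProperty.mono {S T U S' T' U' : Set G} (h : SetTripleProductProperty S T U)
    (hS : S' ⊆ S) (hT : T' ⊆ T) (hU : U' ⊆ U) : SetTripleProductProperty S' T' U' :=
  fun s hs s' hs' t ht t' ht' u hu u' hu' =>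
    h s (hS hs) s' (hS hs') t (hT ht) t' (hT ht') u (hU hu) u' (hU hu')

end TPP

section KTPP

variable {M : Type u} [Monoid M]

/-- **`K`-triple product property** (BCGPU 2023, Lemma 4.8: "Suppose that `H₁`, `H₂`, and `H₃` are
Lie subgroups of a Lie group `G` and `K` is a compact subgroup of `G` such that the equation
`h₁h₂h₃ = 1` with `hᵢ ∈ Hᵢ` implies that `h₁, h₂, h₃ ∈ K`. … We will refer to this situation as the
`K`-triple product property"). Stated for four subsets of a monoid (membership, `*` and `1` are all
that is used); for subgroups `Hᵢ` and `K = {1}` it is the subgroup triple product property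
(`kTripleProductProperty_bot_iff`). The printed "more generally" variant for submanifolds (`q₁q₂q₃ = 1`
with `qᵢ ∈ Q(Mᵢ)`) is not needed in §4 and not typed. [cite: BlasiakCohnGrochowPrattUmans2023, Lemma 4.8] -/
def KTripleProductProperty (H₁ H₂ H₃ K : Set M) : Prop :=
  ∀ a ∈ H₁, ∀ b ∈ H₂, ∀ c ∈ H₃, a * b * c = 1 → a ∈ K ∧ b ∈ K ∧ c ∈ K

/-- Enlarging `K` preserves the `K`-triple product property (immediate from the definition in
Lemma 4.8). [cite: BlasiakCohnGrochowPrattUmans2023, Lemma 4.8] -/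
theorem KTripleProductProperty.mono_right {H₁ H₂ H₃ K K' : Set M}
    (h : KTripleProductProperty H₁ H₂ H₃ K) (hK : K ⊆ K') : KTripleProductProperty H₁ H₂ H₃ K' :=
  fun a ha b hb c hc habc =>
    let ⟨h1, h2, h3⟩ := h a ha b hb c hc habc
    ⟨hK h1, hK h2, hK h3⟩

/-- Shrinking the three sets preserves the `K`-triple product property (immediate from the
definition in Lemma 4.8; this is how Lemma 4.8 passes to the submanifolds `Hᵢ' ⊆ Hᵢ`).
[cite: BlasiakCohnGrochowPrattUmans2023, Lemma 4.8 (proof)] -/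
theorem KTripleProductProperty.anti {H₁ H₂ H₃ H₁' H₂' H₃' K : Set M}
    (h : KTripleProductProperty H₁ H₂ H₃ K) (h₁ : H₁' ⊆ H₁) (h₂ : H₂' ⊆ H₂) (h₃ : H₃' ⊆ H₃) :
    KTripleProductProperty H₁' H₂' H₃' K :=
  fun a ha b hb c hc habc => h a (h₁ ha) b (h₂ hb) c (h₃ hc) habc

/-- For subgroups `H₁, H₂, H₃` and `K = {1}`, the `K`-triple product property is the subgroup triple
product property of the tree (`Literature.Barriers.MatrixMultiplication.SubgroupTPP`, BCGPU Def. 2.1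
for subgroups). [cite: BlasiakCohnGrochowPrattUmans2023, Def. 2.1 and Lemma 4.8] -/
theorem kTripleProductProperty_bot_iff {G : Type u} [Group G] (H₁ H₂ H₃ : Subgroup G) :
    KTripleProductProperty (H₁ : Set G) H₂ H₃ ((⊥ : Subgroup G) : Set G) ↔
      Literature.Barriers.MatrixMultiplication.SubgroupTPP H₁ H₂ H₃ := by
  simp only [KTripleProductProperty, Literature.Barriers.MatrixMultiplication.SubgroupTPP,
    SetLike.mem_coe, Subgroup.mem_bot]

end KTPP

/-! ## The Lie-exponent quotient (Def. 4.1, Lemma 4.8) on numerical data -/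

section LieExponentArithmetic

/-- **The quotient bounding the Lie exponent** (BCGPU 2023, Def. 4.1 and Lemma 4.8): for a Lie group of
rank `r` and dimension `d` and a `K`-triple-product-property triple of Lie subgroups of dimensions
`m₁, m₂, m₃` with `dim K = k`, "the Lie exponent of `G` is at most
`r(G) / ((dim H₁ + dim H₂ + dim H₃ − 2 dim K)/3 − (dim G − r(G))/2)`" (Def. 4.1 is the case
`k = 0` with submanifolds `Mᵢ`, `ω(G)` being the infimum of this quantity over all TPP triples with
positive denominator). Only this function of the six numbers is typed — the Lie exponent itself is not
(module docstring, "What is NOT typed"). Lean's `x / 0 = 0` is a junk value where the printed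
denominator vanishes. [cite: BlasiakCohnGrochowPrattUmans2023, Def. 4.1 and Lemma 4.8] -/
def lieExponentQuotient (r d m₁ m₂ m₃ k : ℝ) : ℝ :=
  r / ((m₁ + m₂ + m₃ - 2 * k) / 3 - (d - r) / 2)

/-- Unfolding lemma. [cite: BlasiakCohnGrochowPrattUmans2023, Def. 4.1] -/
theorem lieExponentQuotient_def (r d m₁ m₂ m₃ k : ℝ) :
    lieExponentQuotient r d m₁ m₂ m₃ k = r / ((m₁ + m₂ + m₃ - 2 * k) / 3 - (d - r) / 2) := rfl

/-- **Prop. 4.3, final step** ("Averaging these inequalities shows that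
`(dim M₁ + dim M₂ + dim M₃)/3 ≤ (dim G)/2`, and therefore the bound we obtain for `ω(G)` is at least
`r(G) / ((dim G)/2 − (dim G − r(G))/2) = 2`"): if `(m₁ + m₂ + m₃)/3 ≤ d/2` and the denominator is
positive then the quotient is `≥ 2`. The geometric input (`dim Mᵢ + dim Mⱼ ≤ dim G` from the
injectivity of `(mᵢ, mⱼ) ↦ mᵢ⁻¹ mⱼ`) is not typed. [cite: BlasiakCohnGrochowPrattUmans2023, Prop. 4.3 (proof)] -/
theorem two_le_lieExponentQuotient {r d m₁ m₂ m₃ : ℝ}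
    (havg : (m₁ + m₂ + m₃) / 3 ≤ d / 2) (hden : (d - r) / 2 < (m₁ + m₂ + m₃) / 3) :
    2 ≤ lieExponentQuotient r d m₁ m₂ m₃ 0 := by
  unfold lieExponentQuotient
  have hpos : 0 < (m₁ + m₂ + m₃ - 2 * 0) / 3 - (d - r) / 2 := by linarith
  rw [le_div_iff₀ hpos]
  linarith

/-- **Remark after Prop. 4.3 / Prop. 4.4, lower bound** ("if `dim M₁ + dim M₂ + dim M₃ ≤ dim G`, then
they cannot prove any better upper bound for `ω(G)` than `3` … it follows from `r(G) ≤ dim G`"):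
if `m₁ + m₂ + m₃ ≤ d`, `r ≤ d` and the denominator is positive then the quotient is `≥ 3`.
[cite: BlasiakCohnGrochowPrattUmans2023, Prop. 4.4 (and the remark preceding it)] -/
theorem three_le_lieExponentQuotient {r d m₁ m₂ m₃ : ℝ} (hr : r ≤ d)
    (hsum : m₁ + m₂ + m₃ ≤ d) (hden : (d - r) / 2 < (m₁ + m₂ + m₃) / 3) :
    3 ≤ lieExponentQuotient r d m₁ m₂ m₃ 0 := by
  unfold lieExponentQuotient
  have hpos : 0 < (m₁ + m₂ + m₃ - 2 * 0) / 3 - (d - r) / 2 := by linarith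
  rw [le_div_iff₀ hpos]
  linarith

/-- **Prop. 4.4, upper bound** ("Let `H₁ = G` and `H₂ = H₃ = {1}` … Since `r(G) = dim G` and
`dim H₁ + dim H₂ + dim H₃ = dim G`, it follows that `ω(G) ≤ 3`"): with `r = d = m₁`, `m₂ = m₃ = 0`
the quotient equals `3` (for `d ≠ 0`; all Lie groups of the paper are positive-dimensional).
[cite: BlasiakCohnGrochowPrattUmans2023, Prop. 4.4 (proof)] -/
theorem lieExponentQuotient_whole_group {d : ℝ} (hd : d ≠ 0) :
    lieExponentQuotient d d d 0 0 0 = 3 := by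
  unfold lieExponentQuotient
  field_simp
  ring

/-- **Prop. 4.6, the inequality of its proof** ("It suffices to show that …
`r(G) / ((Σ dim Mᵢ)/3 − (dim G − r(G))/2) ≥ dim G / ((Σ dim Mᵢ)/3)`. This assertion follows from the
inequality `(Σ dim Mᵢ)/3 ≤ (dim G)/2`"): for `0 ≤ r ≤ d`, `0 < m₁ + m₂ + m₃`,
`(m₁ + m₂ + m₃)/3 ≤ d/2` and positive denominator, `d / ((m₁+m₂+m₃)/3) ≤` the quotient. Hence Lie
groups with `ω(Gᵢ) → 2` meet the (Lie) packing bound of Def. 4.5 — that consequence is not typed.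
[cite: BlasiakCohnGrochowPrattUmans2023, Prop. 4.6 (proof)] -/
theorem div_le_lieExponentQuotient {r d m₁ m₂ m₃ : ℝ} (hr : r ≤ d)
    (hpos : 0 < m₁ + m₂ + m₃) (havg : (m₁ + m₂ + m₃) / 3 ≤ d / 2)
    (hden : (d - r) / 2 < (m₁ + m₂ + m₃) / 3) :
    d / ((m₁ + m₂ + m₃) / 3) ≤ lieExponentQuotient r d m₁ m₂ m₃ 0 := by
  unfold lieExponentQuotient
  have hD : 0 < (m₁ + m₂ + m₃ - 2 * 0) / 3 - (d - r) / 2 := by linarith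
  have hs : 0 < (m₁ + m₂ + m₃) / 3 := by linarith
  rw [div_le_div_iff₀ hs hD]
  nlinarith

/-- **Thm. 4.9, dimension bookkeeping** ("These subgroups have dimensions `mn(n−1)/2`, `mn(n−1)/2`, and
`m(n(n+1)/2 − 1) − n`, respectively … Since `dim SL(n,ℝ)^m = m(n²−1)` and the rank of `SL(n,ℝ)^m` is
`m(n−1)`, while `dim K = 0`, the claimed bound on the Lie exponent will follow by Lemma 4.8"): with
these values the quotient of Lemma 4.8 equals the printed `3m(n−1)/(m(n−1)−n)` (an identity of
rational functions; both sides are Lean-junk `0` when `m(n−1) = n`).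
[cite: BlasiakCohnGrochowPrattUmans2023, Thm. 4.9 (proof)] -/
theorem lieExponentQuotient_thm49 (m n : ℝ) :
    lieExponentQuotient (m * (n - 1)) (m * (n ^ 2 - 1)) (m * n * (n - 1) / 2) (m * n * (n - 1) / 2)
      (m * (n * (n + 1) / 2 - 1) - n) 0 = 3 * m * (n - 1) / (m * (n - 1) - n) := by
  unfold lieExponentQuotient
  have h : (m * n * (n - 1) / 2 + m * n * (n - 1) / 2 + (m * (n * (n + 1) / 2 - 1) - n) - 2 * 0) / 3
      - (m * (n ^ 2 - 1) - m * (n - 1)) / 2 = (m * (n - 1) - n) / 3 := by ring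
  rw [h, div_div_eq_mul_div]
  ring

end LieExponentArithmetic

/-! ## Thm. 4.7: subvarieties of algebraic groups over algebraically closed fields cannot help -/

section AlgebraicGroups

variable (k : Type u) [Field k] {ι : Type*} [Fintype ι] [DecidableEq ι]

/-- The matrix entries of `g ∈ GL_ι(k)` as a point of the affine space `k^{ι × ι}` (`GL_ι(k)` is the
basic open subset `det ≠ 0` of that affine space). [folklore] -/
def glEntries (g : GL ι k) : ι × ι → k := fun ij => (g : Matrix ι ι k) ij.1 ij.2

/-- `glEntries` is injective (a unit of the matrix ring is determined by its matrix), so subsets of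
`GL_ι(k)` are faithfully subsets of the affine space of matrices, as in "linear algebraic groups …,
i.e., subgroups of `GL(n,ℝ)` defined by polynomial equations".
[cite: BlasiakCohnGrochowPrattUmans2023, §4 (paragraph before Thm. 4.7)] -/
theorem glEntries_injective : Function.Injective (glEntries k (ι := ι)) := by
  intro g h hgh
  apply Units.ext
  ext i j
  exact congrFun hgh (i, j)

/-- **Zariski-closed subset of `GL_ι(k)`**: `V` is the trace on `GL_ι(k)` of the zero locus of an ideal
of polynomials in the matrix entries (the closed subsets of the open subvariety `GL_ι = {det ≠ 0}` of
the affine space of matrices are exactly such traces). A Zariski-closed SUBGROUP of `GL_ι(k)` is an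
affine (= linear) algebraic group through its `k`-points, and every affine algebraic group arises so.
(The tree's `Literature.Geometry.Kaehler.ComplexTorus.IsZariskiClosedGL` is the same notion for
subgroups over `ℂ`; here arbitrary subsets and fields are needed.) BCGPU §4: "linear algebraic
groups over `ℝ`, i.e., subgroups of `GL(n,ℝ)` defined by polynomial equations".
[cite: BlasiakCohnGrochowPrattUmans2023, §4 (paragraph before Thm. 4.7)] -/
def IsClosedInGL (V : Set (GL ι k)) : Prop :=
  ∃ I : Ideal (MvPolynomial (ι × ι) k), V = {g | glEntries k g ∈ MvPolynomial.zeroLocus k I}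

/-- **Dimension** of a subset `V ⊆ GL_ι(k)`: the Krull dimension of the coordinate ring
`k[x_{ij}] / I(V)` of its Zariski closure in the affine space of matrices (`I(V)` = the polynomials
in the entries vanishing on `V`). For `V` closed in `GL_ι(k)` this is `dim V` (every irreducible
component of the closure meets the dense open `GL_ι`); it is the maximum of the dimensions of the
irreducible components, and `⊥` for `V = ∅`. Values in `WithBot ℕ∞` as Mathlib's `ringKrullDim`.
[folklore] -/
def dimGL (V : Set (GL ι k)) : WithBot ℕ∞ :=
  ringKrullDim (MvPolynomial (ι × ι) k ⧸ MvPolynomial.vanishingIdeal k (glEntries k '' V))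

/-- The whole group `GL_ι(k)` is Zariski-closed in itself (the zero ideal): the ambient algebraic
group of Thm. 4.7 may be `GL_ι` itself. [cite: BlasiakCohnGrochowPrattUmans2023, §4 (paragraph before Thm. 4.7)] -/
theorem isClosedInGL_univ : IsClosedInGL k (Set.univ : Set (GL ι k)) :=
  ⟨⊥, by simp⟩

/-- **Blasiak–Cohn–Grochow–Pratt–Umans 2023, Theorem 4.7** ("Let `G` be an algebraic group over an
algebraically closed field, and let `V₁`, `V₂`, and `V₃` be subvarieties of `G` that satisfy the triple
product property. Then `dim V₁ + dim V₂ + dim V₃ ≤ dim G`. As a consequence, subvarieties of algebraic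
groups over `ℂ` cannot be used to meet the packing bound or obtain a better Lie exponent than `3`"),
typed for AFFINE algebraic groups presented as Zariski-closed subgroups `G ≤ GL_ι(k)` and closed
subvarieties `Vᵢ ⊆ G` (closed in `GL_ι(k)`, equivalently in `G`), the TPP being that of the abstract
group `G(k)` (Def. 2.1, `SetTripleProductProperty`) and `dim` the Krull dimension of the coordinate
ring (`dimGL`). Proof in print: the fibre of `(v₁,v₂,v₃) ↦ v₁v₁'⁻¹v₂v₂'⁻¹v₃v₃'⁻¹` over `1` is the single
point `(v₁',v₂',v₃')` by the TPP, and the fibre dimension theorem bounds its dimension below by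
`Σ dim Vᵢ − dim G`. TODO(general form): arbitrary (non-affine) algebraic groups and locally closed
subvarieties. Known theorem; statement only (Mathlib has no fibre dimension theorem).
[cite: BlasiakCohnGrochowPrattUmans2023, Thm. 4.7] -/
def BCGPU2023_thm47 : Prop :=
  ∀ (k : Type) [Field k] [IsAlgClosed k] (ι : Type) [Fintype ι] [DecidableEq ι]
    (G : Subgroup (GL ι k)), IsClosedInGL k (G : Set (GL ι k)) →
    ∀ V₁ V₂ V₃ : Set (GL ι k), V₁ ⊆ (G : Set (GL ι k)) → V₂ ⊆ (G : Set (GL ι k)) →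
      V₃ ⊆ (G : Set (GL ι k)) → IsClosedInGL k V₁ → IsClosedInGL k V₂ → IsClosedInGL k V₃ →
      SetTripleProductProperty V₁ V₂ V₃ →
        dimGL k V₁ + dimGL k V₂ + dimGL k V₃ ≤ dimGL k (G : Set (GL ι k))

end AlgebraicGroups

/-! ## Thm. 4.9: the construction in `SL(n,ℝ)^m` -/

section SLnPowers

/-- The Lie group `SL(n,ℝ)^m` (as an abstract group: `m`-tuples of real `n × n` matrices of
determinant `1`, componentwise product). [cite: BlasiakCohnGrochowPrattUmans2023, Thm. 4.9] -/
abbrev SLPow (m n : ℕ) : Type := Fin m → Matrix.SpecialLinearGroup (Fin n) ℝ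

variable (m n : ℕ)

/-- `H₁ = SO(n,ℝ)^m ≤ SL(n,ℝ)^m`: every component is orthogonal, `(M⁽ⁱ⁾)ᵀ M⁽ⁱ⁾ = 1` (and has
determinant `1`, being in `SL(n,ℝ)`). [cite: BlasiakCohnGrochowPrattUmans2023, Thm. 4.9 (proof)] -/
def soPow : Set (SLPow m n) :=
  {M | ∀ i, ((M i : Matrix (Fin n) (Fin n) ℝ))ᵀ * (M i : Matrix (Fin n) (Fin n) ℝ) = 1}

/-- `H₂ = {(A⁽¹⁾, …, A⁽ᵐ⁾) ∈ SL(n,ℝ)^m : each A⁽ⁱ⁾ is upper unitriangular}` (zero below the diagonal,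
`1` on it). [cite: BlasiakCohnGrochowPrattUmans2023, Thm. 4.9 (proof)] -/
def upperUnitriangularPow : Set (SLPow m n) :=
  {A | ∀ i, (∀ j l : Fin n, l < j → (A i : Matrix (Fin n) (Fin n) ℝ) j l = 0) ∧
    ∀ j : Fin n, (A i : Matrix (Fin n) (Fin n) ℝ) j j = 1}

/-- `H₃ = {(B⁽¹⁾, …, B⁽ᵐ⁾) ∈ SL(n,ℝ)^m : each B⁽ⁱ⁾ is lower triangular and ∏ᵢ B⁽ⁱ⁾ⱼⱼ = 1 for all j}`.
[cite: BlasiakCohnGrochowPrattUmans2023, Thm. 4.9 (proof)] -/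
def lowerTriangularProdOnePow : Set (SLPow m n) :=
  {B | (∀ i, ∀ j l : Fin n, j < l → (B i : Matrix (Fin n) (Fin n) ℝ) j l = 0) ∧
    ∀ j : Fin n, ∏ i, (B i : Matrix (Fin n) (Fin n) ℝ) j j = 1}

/-- `K = {(C⁽¹⁾, …, C⁽ᵐ⁾) ∈ SL(n,ℝ)^m : each C⁽ⁱ⁾ is diagonal with ±1 entries}` (a finite group,
`dim K = 0`). [cite: BlasiakCohnGrochowPrattUmans2023, Thm. 4.9 (proof)] -/
def signDiagonalPow : Set (SLPow m n) :=
  {C | ∀ i, ∀ j l : Fin n, (j ≠ l → (C i : Matrix (Fin n) (Fin n) ℝ) j l = 0) ∧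
    ((C i : Matrix (Fin n) (Fin n) ℝ) j j = 1 ∨ (C i : Matrix (Fin n) (Fin n) ℝ) j j = -1)}

/-- The identity tuple lies in all four sets (they are the carriers of the subgroups `H₁, H₂, H₃, K`
of the printed proof). [cite: BlasiakCohnGrochowPrattUmans2023, Thm. 4.9 (proof)] -/
theorem one_mem_soPow_inter :
    (1 : SLPow m n) ∈ soPow m n ∩ upperUnitriangularPow m n ∩ lowerTriangularProdOnePow m n ∩
      signDiagonalPow m n := by
  refine ⟨⟨⟨fun i => by simp, fun i => ⟨fun j l hjl => ?_, fun j => by simp⟩⟩,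
    ⟨fun i j l hjl => ?_, fun j => by simp⟩⟩, fun i j l => ⟨fun hjl => ?_, Or.inl (by simp)⟩⟩
  · simp [(ne_of_lt hjl).symm]
  · simp [ne_of_lt hjl]
  · simp [hjl]

/-- **Blasiak–Cohn–Grochow–Pratt–Umans 2023, Theorem 4.9** ("For `m > 1` and `n > 1`, the Lie exponent
of `SL(n,ℝ)^m` is at most `3m(n−1)/(m(n−1)−n)`"), typed as the claim its proof establishes: the
subgroups `H₁ = SO(n,ℝ)^m` (`soPow`), `H₂` = tuples of upper unitriangular matrices
(`upperUnitriangularPow`), `H₃` = tuples of lower triangular matrices with `∏ᵢ B⁽ⁱ⁾ⱼⱼ = 1` for every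
`j` (`lowerTriangularProdOnePow`) "satisfy the `K`-triple product property in `SL(n,ℝ)^m`, where `K`"
is the group of tuples of diagonal `±1` matrices (`signDiagonalPow`) — i.e. `h₁h₂h₃ = 1` with
`hᵢ ∈ Hᵢ` forces `h₁, h₂, h₃ ∈ K` (printed proof: if `MA = B` then each `M⁽ⁱ⁾` is diagonal with `±1`
entries, by induction on the columns using `|B⁽ⁱ⁾ⱼⱼ| ≤ 1` and `∏ᵢ B⁽ⁱ⁾ⱼⱼ = 1`). The passage to the
Lie exponent is Lemma 4.8 with the dimensions recorded in `lieExponentQuotient_thm49` (see the module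
docstring: the Lie exponent itself is not a Lean object here). Known theorem; statement only.
[cite: BlasiakCohnGrochowPrattUmans2023, Thm. 4.9] -/
def BCGPU2023_thm49 : Prop :=
  ∀ m n : ℕ, 1 < m → 1 < n →
    KTripleProductProperty (soPow m n) (upperUnitriangularPow m n) (lowerTriangularProdOnePow m n)
      (signDiagonalPow m n)

end SLnPowers

/-! ## Proof of Thm. 4.9 (the printed column induction) -/

section Thm49Proof

/-- If finitely many reals in `[0,1]` have product `1`, each of them is `1` (the step "`|B⁽ⁱ⁾ⱼⱼ| ≤ 1`
for all `i`; but since `∏ᵢ B⁽ⁱ⁾ⱼⱼ = 1` this forces `B⁽ⁱ⁾ⱼⱼ = ±1`" of the printed proof).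
[cite: BlasiakCohnGrochowPrattUmans2023, Thm. 4.9 (proof)] -/
private theorem eq_one_of_prod_eq_one_of_le_one {ι : Type*} [Fintype ι] {x : ι → ℝ}
    (h0 : ∀ i, 0 ≤ x i) (h1 : ∀ i, x i ≤ 1) (hprod : ∏ i, x i = 1) (i : ι) : x i = 1 := by
  classical
  by_contra hne
  have hlt : x i < 1 := lt_of_le_of_ne (h1 i) hne
  have hrest : ∏ j ∈ Finset.univ.erase i, x j ≤ 1 :=
    Finset.prod_le_one (fun j _ => h0 j) (fun j _ => h1 j)
  have hlt' : ∏ j, x j < 1 := by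
    rw [← Finset.mul_prod_erase Finset.univ x (Finset.mem_univ i)]
    calc x i * ∏ j ∈ Finset.univ.erase i, x j ≤ x i * 1 :=
          mul_le_mul_of_nonneg_left hrest (h0 i)
      _ < 1 := by rw [mul_one]; exact hlt
  linarith

/-- **Blasiak–Cohn–Grochow–Pratt–Umans 2023, Theorem 4.9, proved** — the `K`-triple product property
of `H₁ = SO(n,ℝ)^m`, `H₂` (upper unitriangular tuples), `H₃` (lower triangular tuples with
`∏ᵢ B⁽ⁱ⁾ⱼⱼ = 1`) in `SL(n,ℝ)^m`, following the printed proof: from `M A C = 1` (`M ∈ H₁`, `A ∈ H₂`,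
`C ∈ H₃`) one gets `A C = Mᵀ`, whose columns are unit vectors; by induction over the columns
`k = n, n−1, …, 1` (simultaneously for all `i`), column `k` of `A⁽ⁱ⁾C⁽ⁱ⁾` is
`(A⁽ⁱ⁾_{jk} C⁽ⁱ⁾_{kk})_{j<k} ⊕ C⁽ⁱ⁾_{kk} ⊕ (C⁽ⁱ⁾_{jk})_{j>k}`, so `|C⁽ⁱ⁾_{kk}| ≤ 1` for every `i`,
and `∏ᵢ C⁽ⁱ⁾_{kk} = 1` forces `C⁽ⁱ⁾_{kk} = ±1` and the remaining entries of the column to vanish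
(the printed proof runs the same induction on `M A = B` with `B = C⁻¹`; using `A C = Mᵀ` instead
avoids inverting the triangular factor). Hence `A = 1`, `C = diag(±1)` and `M = Cᵀ = C`, all in `K`.
[cite: BlasiakCohnGrochowPrattUmans2023, Thm. 4.9] -/
theorem BCGPU2023_thm49_holds : BCGPU2023_thm49 := by
  intro m n _hm _hn a ha b hb c hc habc
  classical
  -- the real matrices and the hypotheses entrywise
  set M : Fin m → Matrix (Fin n) (Fin n) ℝ := fun i => (a i : Matrix (Fin n) (Fin n) ℝ) with hM
  set A : Fin m → Matrix (Fin n) (Fin n) ℝ := fun i => (b i : Matrix (Fin n) (Fin n) ℝ) with hA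
  set C : Fin m → Matrix (Fin n) (Fin n) ℝ := fun i => (c i : Matrix (Fin n) (Fin n) ℝ) with hC
  have hMM : ∀ i, (M i)ᵀ * M i = 1 := fun i => ha i
  have hAup : ∀ i (j l : Fin n), l < j → A i j l = 0 := fun i => (hb i).1
  have hAdiag : ∀ i (j : Fin n), A i j j = 1 := fun i => (hb i).2
  have hClow : ∀ i (j l : Fin n), j < l → C i j l = 0 := hc.1
  have hCprod : ∀ j : Fin n, ∏ i, C i j j = 1 := hc.2
  have hMAC : ∀ i, M i * A i * C i = 1 := by
    intro i
    have h := congrFun habc i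
    simp only [Pi.mul_apply, Pi.one_apply] at h
    have h' := congrArg (fun g : Matrix.SpecialLinearGroup (Fin n) ℝ => (g : Matrix (Fin n) (Fin n) ℝ)) h
    simpa only [Matrix.SpecialLinearGroup.coe_mul, Matrix.SpecialLinearGroup.coe_one] using h'
  -- `A C = Mᵀ`, whose columns are unit vectors
  have hACt : ∀ i, A i * C i = (M i)ᵀ := by
    intro i
    calc A i * C i = (M i)ᵀ * M i * A i * C i := by rw [hMM i, Matrix.one_mul]
      _ = (M i)ᵀ * (M i * A i * C i) := by simp only [Matrix.mul_assoc]
      _ = (M i)ᵀ := by rw [hMAC i, Matrix.mul_one]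
  have hunit : ∀ i (k : Fin n), ∑ j, ((A i * C i) j k) ^ 2 = 1 := by
    intro i k
    have hMMt : M i * (M i)ᵀ = 1 := mul_eq_one_comm.1 (hMM i)
    have h := congrFun (congrFun hMMt k) k
    rw [Matrix.mul_apply, Matrix.one_apply_eq] at h
    rw [hACt i]
    simpa only [Matrix.transpose_apply, pow_two] using h
  -- induction over the columns from the last one: column `l` of `A⁽ⁱ⁾` is `e_l`, column `l` of
  -- `C⁽ⁱ⁾` is `± e_l`, for the last `t` columns and every `i`
  have key : ∀ t : ℕ, ∀ i, ∀ l : Fin n, n ≤ (l : ℕ) + t →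
      C i l l ^ 2 = 1 ∧ ∀ j, j ≠ l → A i j l = 0 ∧ C i j l = 0 := by
    intro t
    induction t with
    | zero =>
      intro i l hl
      exact absurd hl (by omega)
    | succ t ih =>
      intro i₀ k hk
      by_cases hk' : n ≤ (k : ℕ) + t
      · exact ih i₀ k hk'
      -- `k` is the next column; all columns `l > k` are done, for every `i`
      have hdone : ∀ i, ∀ l : Fin n, k < l →
          C i l l ^ 2 = 1 ∧ ∀ j, j ≠ l → A i j l = 0 ∧ C i j l = 0 :=
        fun i l hkl => ih i l (by have := Fin.lt_def.1 hkl; omega)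
      -- the entries of column `k` of `A C`
      have hNle : ∀ i (j : Fin n), j ≤ k → (A i * C i) j k = A i j k * C i k k := by
        intro i j hj
        rw [Matrix.mul_apply]
        refine Finset.sum_eq_single k (fun l _ hl => ?_) (fun h => absurd (Finset.mem_univ k) h)
        rcases lt_or_gt_of_ne hl with hlk | hkl
        · rw [hClow i l k hlk, mul_zero]
        · rw [((hdone i l hkl).2 j (ne_of_lt (lt_of_le_of_lt hj hkl))).1, zero_mul]
      have hNgt : ∀ i (j : Fin n), k < j → (A i * C i) j k = C i j k := by
        intro i j hj
        rw [Matrix.mul_apply, Finset.sum_eq_single j (fun l _ hl => ?_)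
          (fun h => absurd (Finset.mem_univ j) h), hAdiag, one_mul]
        rcases lt_or_gt_of_ne hl with hlj | hjl
        · rw [hAup i j l hlj, zero_mul]
        · rw [((hdone i l (hj.trans hjl)).2 j (ne_of_lt hjl)).1, zero_mul]
      -- `C_kk² ≤ 1` for every `i`, hence `C_kk² = 1` since `∏ᵢ C⁽ⁱ⁾_kk = 1`
      have hle1 : ∀ i, C i k k ^ 2 ≤ 1 := by
        intro i
        have hkk : (A i * C i) k k ^ 2 = C i k k ^ 2 := by rw [hNle i k le_rfl, hAdiag, one_mul]
        rw [← hkk, ← hunit i k]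
        exact Finset.single_le_sum (fun j _ => sq_nonneg ((A i * C i) j k)) (Finset.mem_univ k)
      have hsq : ∀ i, C i k k ^ 2 = 1 := by
        refine eq_one_of_prod_eq_one_of_le_one (fun i => sq_nonneg _) hle1 ?_
        rw [Finset.prod_pow, hCprod k, one_pow]
      -- so the other entries of column `k` of `A⁽ⁱ⁾ C⁽ⁱ⁾` vanish
      have hzero : ∀ j, j ≠ k → (A i₀ * C i₀) j k = 0 := by
        have h := hunit i₀ k
        rw [← Finset.add_sum_erase Finset.univ _ (Finset.mem_univ k), hNle i₀ k le_rfl, hAdiag,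
          one_mul, hsq i₀] at h
        have h0 : ∑ j ∈ Finset.univ.erase k, (A i₀ * C i₀) j k ^ 2 = 0 := by linarith
        intro j hj
        have hj0 := (Finset.sum_eq_zero_iff_of_nonneg fun j _ => sq_nonneg ((A i₀ * C i₀) j k)).1
          h0 j (Finset.mem_erase.2 ⟨hj, Finset.mem_univ j⟩)
        by_contra hne
        have hpos : 0 < (A i₀ * C i₀) j k ^ 2 := by positivity
        linarith
      refine ⟨hsq i₀, fun j hj => ?_⟩
      rcases lt_or_gt_of_ne hj with hjk | hkj
      · -- `j < k`: `A_jk C_kk = 0` with `C_kk ≠ 0`; `C_jk = 0` as `C` is lower triangular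
        have h1 := hzero j hj
        rw [hNle i₀ j hjk.le] at h1
        have hCkk : C i₀ k k ≠ 0 := by
          intro h0
          have h2 := hsq i₀
          rw [h0] at h2
          norm_num at h2
        exact ⟨(mul_eq_zero.1 h1).resolve_right hCkk, hClow i₀ j k hjk⟩
      · -- `j > k`: `A_jk = 0` as `A` is upper triangular; `C_jk = (A C)_jk = 0`
        have h1 := hzero j hj
        rw [hNgt i₀ j hkj] at h1
        exact ⟨hAup i₀ j k hkj, h1⟩
  have hQ : ∀ i (l : Fin n), C i l l ^ 2 = 1 ∧ ∀ j, j ≠ l → A i j l = 0 ∧ C i j l = 0 :=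
    fun i l => key n i l (by omega)
  -- hence `A = 1`, `C = diag(±1)` and `M = Cᵀ`
  have hMentry : ∀ i (j l : Fin n), M i j l = C i l j := by
    intro i j l
    have h := congrFun (congrFun (hACt i) l) j
    rw [Matrix.transpose_apply, Matrix.mul_apply, Finset.sum_eq_single l (fun x _ hx => ?_)
      (fun h => absurd (Finset.mem_univ l) h), hAdiag, one_mul] at h
    · exact h.symm
    · rw [((hQ i x).2 l (Ne.symm hx)).1, zero_mul]
  have hCdiag : ∀ i (j : Fin n), C i j j = 1 ∨ C i j j = -1 := fun i j =>
    mul_self_eq_one_iff.1 (by rw [← pow_two]; exact (hQ i j).1)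
  refine ⟨?_, ?_, ?_⟩
  · intro i j l
    show (j ≠ l → M i j l = 0) ∧ (M i j j = 1 ∨ M i j j = -1)
    exact ⟨fun hjl => by rw [hMentry]; exact ((hQ i j).2 l (Ne.symm hjl)).2,
      by rw [hMentry]; exact hCdiag i j⟩
  · intro i j l
    exact ⟨fun hjl => ((hQ i l).2 j hjl).1, Or.inl (hAdiag i j)⟩
  · intro i j l
    exact ⟨fun hjl => ((hQ i l).2 j hjl).2, hCdiag i j⟩

end Thm49Proof

/-! ## Thm. 4.10: three conjugates of `O(n,ℝ)` in `GL(n,ℝ)` -/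

section RotationGroups

variable (n : ℕ)

/-- `O(n,ℝ) ≤ GL(n,ℝ)`: the invertible real matrices `g` with `gᵀ g = 1`.
[cite: BlasiakCohnGrochowPrattUmans2023, Thm. 4.10] -/
def orthogonalGL : Set (GL (Fin n) ℝ) :=
  {g | ((g : Matrix (Fin n) (Fin n) ℝ))ᵀ * (g : Matrix (Fin n) (Fin n) ℝ) = 1}

/-- The conjugate `g S g⁻¹` of a subset `S` of a group. [folklore] -/
def conjugateSet {G : Type u} [Group G] (g : G) (S : Set G) : Set G :=
  (fun h => g * h * g⁻¹) '' S

/-- `K ≤ GL(n,ℝ)`: the diagonal matrices with `±1` entries on the diagonal.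
[cite: BlasiakCohnGrochowPrattUmans2023, Thm. 4.10] -/
def signDiagonalGL : Set (GL (Fin n) ℝ) :=
  {g | ∀ j l : Fin n, (j ≠ l → (g : Matrix (Fin n) (Fin n) ℝ) j l = 0) ∧
    ((g : Matrix (Fin n) (Fin n) ℝ) j j = 1 ∨ (g : Matrix (Fin n) (Fin n) ℝ) j j = -1)}

/-- `1 ∈ O(n,ℝ)` (the carrier `orthogonalGL` is that of the subgroup `H = O(n,ℝ)` of the printed
proof). [cite: BlasiakCohnGrochowPrattUmans2023, Thm. 4.10 (proof)] -/
theorem one_mem_orthogonalGL : (1 : GL (Fin n) ℝ) ∈ orthogonalGL n := by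
  simp [orthogonalGL]

/-- `K ⊆ O(n,ℝ)`: a diagonal `±1` matrix is orthogonal (so `K ≤ H ∩ H₁ ∩ H₂` in Thm. 4.10, `K` being
centralised by the diagonal conjugators `D₁, D₂`). [cite: BlasiakCohnGrochowPrattUmans2023, Thm. 4.10 (proof)] -/
theorem signDiagonalGL_subset_orthogonalGL : signDiagonalGL n ⊆ orthogonalGL n := by
  intro g hg
  simp only [signDiagonalGL, Set.mem_setOf_eq] at hg
  simp only [orthogonalGL, Set.mem_setOf_eq]
  ext j l
  rw [Matrix.mul_apply, Finset.sum_eq_single j]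
  · by_cases hjl : j = l
    · subst hjl
      rcases (hg j j).2 with h | h <;> simp [Matrix.transpose_apply, h]
    · simp [Matrix.transpose_apply, (hg j l).1 hjl, hjl]
  · intro i _ hij
    simp [Matrix.transpose_apply, (hg i j).1 hij]
  · simp

/-- **Blasiak–Cohn–Grochow–Pratt–Umans 2023, Theorem 4.10** ("There are three conjugates of `O(n,ℝ)`
inside of `GL(n,ℝ)` satisfying the `K`-triple product property, where `K` is the subgroup of diagonal
matrices with `±1` entries on the diagonal"). As printed (existential); the proof's witnesses are
`H = O(n,ℝ)`, `H₁ = D₁HD₁⁻¹`, `H₂ = D₂HD₂⁻¹` with `D₁ = diag(x₁ > x₂ > ⋯ > xₙ > 0)`,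
`D₂ = diag(0 < y₁ < ⋯ < yₙ)`, via: `h₁ᵀh₁ = h₂ᵀh₂` with `hᵢ ∈ Hᵢ` forces `h₁, h₂ ∈ K` (compare the
upper-left entries, then induct on `n`). "This construction meets the packing bound. In particular,
it evades the normalizer barrier since the normalizer of `O(n,ℝ)` in `GL(n,ℝ)` is `ℝ^× · O(n,ℝ)`.
However, it does not prove a bound for `ω(GL(n,ℝ))`" (each subgroup has dimension
`n(n−1)/2 = (dim GL(n,ℝ) − n)/2` and `r(GL(n,ℝ)) = n`, so the denominator of Def. 4.1 vanishes).
Known theorem; statement only. [cite: BlasiakCohnGrochowPrattUmans2023, Thm. 4.10] -/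
def BCGPU2023_thm410 : Prop :=
  ∀ n : ℕ, ∃ g₁ g₂ : GL (Fin n) ℝ,
    KTripleProductProperty (orthogonalGL n) (conjugateSet g₁ (orthogonalGL n))
      (conjugateSet g₂ (orthogonalGL n)) (signDiagonalGL n)

end RotationGroups

/-! ## Proof of Thm. 4.10 (the printed comparison of diagonal entries, as a column induction) -/

section Thm410Proof

/-- Unit columns of a real matrix `M` with `Mᵀ M = 1`. [folklore] -/
private theorem col_sq_sum_eq_one {n : ℕ} {M : Matrix (Fin n) (Fin n) ℝ} (hM : Mᵀ * M = 1)
    (k : Fin n) : ∑ i, M i k ^ 2 = 1 := by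
  have h := congrFun (congrFun hM k) k
  rw [Matrix.mul_apply, Matrix.one_apply_eq] at h
  simpa only [Matrix.transpose_apply, pow_two] using h

/-- Unit rows of a real matrix `M` with `Mᵀ M = 1` (as `M Mᵀ = 1` too). [folklore] -/
private theorem row_sq_sum_eq_one {n : ℕ} {M : Matrix (Fin n) (Fin n) ℝ} (hM : Mᵀ * M = 1)
    (j : Fin n) : ∑ i, M j i ^ 2 = 1 := by
  have hM' : M * Mᵀ = 1 := mul_eq_one_comm.1 hM
  have h := congrFun (congrFun hM' j) j
  rw [Matrix.mul_apply, Matrix.one_apply_eq] at h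
  simpa only [Matrix.transpose_apply, pow_two] using h

/-- If column `j` of an orthogonal matrix vanishes off the diagonal, its diagonal entry is `±1`.
[folklore] -/
private theorem diag_sq_eq_one_of_col {n : ℕ} {M : Matrix (Fin n) (Fin n) ℝ} (hM : Mᵀ * M = 1)
    {j : Fin n} (hcol : ∀ i, i ≠ j → M i j = 0) : M j j ^ 2 = 1 := by
  classical
  have h := col_sq_sum_eq_one hM j
  rw [← Finset.add_sum_erase _ _ (Finset.mem_univ j)] at h
  have h0 : ∑ i ∈ Finset.univ.erase j, M i j ^ 2 = 0 :=
    Finset.sum_eq_zero fun i hi => by rw [hcol i (Finset.ne_of_mem_erase hi), zero_pow two_ne_zero]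
  linarith

/-- If column `j` of an orthogonal matrix is `± e_j`, then so is row `j` (the block form
"`h₁ = (±1) ⊕ h₁'`" of the printed proof). [cite: BlasiakCohnGrochowPrattUmans2023, Thm. 4.10 (proof)] -/
private theorem row_eq_zero_of_col {n : ℕ} {M : Matrix (Fin n) (Fin n) ℝ} (hM : Mᵀ * M = 1)
    {j : Fin n} (hcol : ∀ i, i ≠ j → M i j = 0) {k : Fin n} (hkj : k ≠ j) : M j k = 0 := by
  classical
  have hjj : M j j ^ 2 = 1 := diag_sq_eq_one_of_col hM hcol
  have h := row_sq_sum_eq_one hM j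
  rw [← Finset.add_sum_erase _ _ (Finset.mem_univ j), hjj] at h
  have h0 : ∑ i ∈ Finset.univ.erase j, M j i ^ 2 = 0 := by linarith
  have hk := (Finset.sum_eq_zero_iff_of_nonneg fun i _ => sq_nonneg (M j i)).1 h0 k
    (Finset.mem_erase.2 ⟨hkj, Finset.mem_univ k⟩)
  by_contra hne
  have hpos : 0 < M j k ^ 2 := by positivity
  linarith

/-- **Core of the printed proof of Thm. 4.10.** For orthogonal `M, N`, strictly decreasing positive
`x` and strictly increasing positive `y`: if the diagonal entries of `(D_x M D_x⁻¹)ᵀ (D_x M D_x⁻¹)`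
and `(D_y N D_y⁻¹)ᵀ (D_y N D_y⁻¹)` agree, then `M` and `N` are `±1`-diagonal. The printed proof
compares the upper-left entries (`≤ 1` resp. `≥ 1`, with equality iff the first columns are
`± e₁`) and inducts on `n` via the block form; here the same comparison is run as an induction over
the columns `k = 1, …, n`, the earlier columns (hence rows) being `± e_j`.
[cite: BlasiakCohnGrochowPrattUmans2023, Thm. 4.10 (proof)] -/
private theorem signDiag_of_diag_entries_eq {n : ℕ} (M N : Matrix (Fin n) (Fin n) ℝ)
    (hM : Mᵀ * M = 1) (hN : Nᵀ * N = 1) (x y : Fin n → ℝ) (hx0 : ∀ i, 0 < x i)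
    (hx : StrictAnti x) (hy0 : ∀ i, 0 < y i) (hy : StrictMono y)
    (hPQ : ∀ k, ∑ i, (x i * M i k * (x k)⁻¹) ^ 2 = ∑ i, (y i * N i k * (y k)⁻¹) ^ 2) (k : Fin n) :
    (∀ i, i ≠ k → M i k = 0 ∧ N i k = 0) ∧ (M k k = 1 ∨ M k k = -1) ∧ (N k k = 1 ∨ N k k = -1) := by
  classical
  have key : ∀ t : ℕ, ∀ k : Fin n, (k : ℕ) < t → ∀ i, i ≠ k → M i k = 0 ∧ N i k = 0 := by
    intro t
    induction t with
    | zero =>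
      intro k hk
      exact absurd hk (Nat.not_lt_zero _)
    | succ t ih =>
      intro k hk
      by_cases hkt : (k : ℕ) < t
      · exact ih k hkt
      have hkeq : (k : ℕ) = t := by omega
      -- the earlier columns, hence the earlier rows, are `± e_j`
      have hcol : ∀ j : Fin n, j < k → ∀ i, i ≠ j → M i j = 0 ∧ N i j = 0 :=
        fun j hj => ih j (by have := Fin.lt_def.1 hj; omega)
      have hrowM : ∀ j : Fin n, j < k → M j k = 0 := fun j hj =>
        row_eq_zero_of_col hM (fun i hi => ((hcol j hj) i hi).1) (ne_of_gt hj)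
      have hrowN : ∀ j : Fin n, j < k → N j k = 0 := fun j hj =>
        row_eq_zero_of_col hN (fun i hi => ((hcol j hj) i hi).2) (ne_of_gt hj)
      -- termwise: `P_kk ≤ Σ_i M_ik² = 1` and `1 = Σ_i N_ik² ≤ Q_kk`
      have hPle : ∀ i, (x i * M i k * (x k)⁻¹) ^ 2 ≤ M i k ^ 2 := by
        intro i
        by_cases hik : i < k
        · rw [hrowM i hik]; simp
        · have hle : x i ≤ x k := hx.antitone (not_lt.1 hik)
          have hr1 : x i / x k ≤ 1 := (div_le_one (hx0 k)).2 hle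
          have hr0 : 0 ≤ x i / x k := div_nonneg (hx0 i).le (hx0 k).le
          calc (x i * M i k * (x k)⁻¹) ^ 2 = (x i / x k) ^ 2 * M i k ^ 2 := by
                rw [div_eq_mul_inv]; ring
            _ ≤ 1 * M i k ^ 2 := by gcongr; exact pow_le_one₀ hr0 hr1
            _ = M i k ^ 2 := one_mul _
      have hQge : ∀ i, N i k ^ 2 ≤ (y i * N i k * (y k)⁻¹) ^ 2 := by
        intro i
        by_cases hik : i < k
        · rw [hrowN i hik]; simp
        · have hle : y k ≤ y i := hy.monotone (not_lt.1 hik)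
          have hr1 : 1 ≤ y i / y k := (one_le_div (hy0 k)).2 hle
          calc N i k ^ 2 = 1 * N i k ^ 2 := (one_mul _).symm
            _ ≤ (y i / y k) ^ 2 * N i k ^ 2 := by gcongr; exact one_le_pow₀ hr1
            _ = (y i * N i k * (y k)⁻¹) ^ 2 := by rw [div_eq_mul_inv]; ring
      have hMc := col_sq_sum_eq_one hM k
      have hNc := col_sq_sum_eq_one hN k
      have hP : ∑ i, (x i * M i k * (x k)⁻¹) ^ 2 = ∑ i, M i k ^ 2 := by
        apply le_antisymm (Finset.sum_le_sum fun i _ => hPle i)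
        rw [hMc, hPQ k, ← hNc]
        exact Finset.sum_le_sum fun i _ => hQge i
      have hQ : ∑ i, N i k ^ 2 = ∑ i, (y i * N i k * (y k)⁻¹) ^ 2 := by
        apply le_antisymm (Finset.sum_le_sum fun i _ => hQge i)
        rw [← hPQ k, hNc, ← hMc]
        exact Finset.sum_le_sum fun i _ => hPle i
      have hPt := (Finset.sum_eq_sum_iff_of_le fun i _ => hPle i).1 hP
      have hQt := (Finset.sum_eq_sum_iff_of_le fun i _ => hQge i).1 hQ
      intro i hik
      rcases lt_or_gt_of_ne hik with hlt | hgt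
      · exact ⟨hrowM i hlt, hrowN i hlt⟩
      · -- `i > k`: the ratios are strict, so the entries vanish
        have hxlt : x i / x k < 1 := (div_lt_one (hx0 k)).2 (hx hgt)
        have hylt : 1 < y i / y k := (one_lt_div (hy0 k)).2 (hy hgt)
        have h1 := hPt i (Finset.mem_univ i)
        have h2 := hQt i (Finset.mem_univ i)
        have e1 : (x i * M i k * (x k)⁻¹) ^ 2 = (x i / x k) ^ 2 * M i k ^ 2 := by
          rw [div_eq_mul_inv]; ring
        have e2 : (y i * N i k * (y k)⁻¹) ^ 2 = (y i / y k) ^ 2 * N i k ^ 2 := by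
          rw [div_eq_mul_inv]; ring
        rw [e1] at h1
        rw [e2] at h2
        have hx1 : (x i / x k) ^ 2 < 1 :=
          pow_lt_one₀ (div_nonneg (hx0 i).le (hx0 k).le) hxlt two_ne_zero
        have hy1 : 1 < (y i / y k) ^ 2 := one_lt_pow₀ hylt two_ne_zero
        have hM0 : M i k ^ 2 = 0 := by nlinarith [sq_nonneg (M i k)]
        have hN0 : N i k ^ 2 = 0 := by nlinarith [sq_nonneg (N i k)]
        exact ⟨(pow_eq_zero_iff two_ne_zero).1 hM0, (pow_eq_zero_iff two_ne_zero).1 hN0⟩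
  have hk := key ((k : ℕ) + 1) k (Nat.lt_succ_self _)
  refine ⟨hk, ?_, ?_⟩
  · exact mul_self_eq_one_iff.1 (by
      rw [← pow_two]; exact diag_sq_eq_one_of_col hM fun i hi => (hk i hi).1)
  · exact mul_self_eq_one_iff.1 (by
      rw [← pow_two]; exact diag_sq_eq_one_of_col hN fun i hi => (hk i hi).2)

/-- A `±1`-diagonal matrix squares to `1`. [folklore] -/
private theorem signDiag_mul_self {n : ℕ} {E : Matrix (Fin n) (Fin n) ℝ}
    (h : ∀ j l, (j ≠ l → E j l = 0) ∧ (E j j = 1 ∨ E j j = -1)) : E * E = 1 := by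
  classical
  ext j l
  rw [Matrix.mul_apply, Finset.sum_eq_single j (fun i _ hi => by rw [(h j i).1 (Ne.symm hi), zero_mul])
    (fun hj => absurd (Finset.mem_univ j) hj)]
  by_cases hjl : j = l
  · subst hjl
    rw [Matrix.one_apply_eq]
    rcases (h j j).2 with h1 | h1 <;> rw [h1] <;> norm_num
  · rw [(h j l).1 hjl, mul_zero, Matrix.one_apply_ne hjl]

/-- The product of two `±1`-diagonal matrices is `±1`-diagonal. [folklore] -/
private theorem signDiag_mul {n : ℕ} {E F : Matrix (Fin n) (Fin n) ℝ}
    (hE : ∀ j l, (j ≠ l → E j l = 0) ∧ (E j j = 1 ∨ E j j = -1))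
    (hF : ∀ j l, (j ≠ l → F j l = 0) ∧ (F j j = 1 ∨ F j j = -1)) :
    ∀ j l, (j ≠ l → (E * F) j l = 0) ∧ ((E * F) j j = 1 ∨ (E * F) j j = -1) := by
  classical
  intro j l
  have hent : ∀ l, (E * F) j l = E j j * F j l := fun l => by
    rw [Matrix.mul_apply, Finset.sum_eq_single j (fun i _ hi => by
      rw [(hE j i).1 (Ne.symm hi), zero_mul]) (fun hj => absurd (Finset.mem_univ j) hj)]
  refine ⟨fun hjl => by rw [hent, (hF j l).1 hjl, mul_zero], ?_⟩
  rw [hent]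
  rcases (hE j j).2 with h1 | h1 <;> rcases (hF j j).2 with h2 | h2 <;> rw [h1, h2] <;> norm_num

/-- **Blasiak–Cohn–Grochow–Pratt–Umans 2023, Theorem 4.10, proved** with the printed witnesses
`H = O(n,ℝ)`, `H₁ = D₁ H D₁⁻¹`, `H₂ = D₂ H D₂⁻¹`, `D₁ = diag(x)` strictly decreasing positive (here
`x_i = 2^{-i}`), `D₂ = diag(y)` strictly increasing positive (`y_i = 2^{i}`): if `a h₁ h₂ = 1` with
`a ∈ H`, `h₁ = D₁M₁D₁⁻¹ ∈ H₁`, `h₂ ∈ H₂`, then `h₁ᵀh₁ = (h₂⁻¹)ᵀ(h₂⁻¹)` with `h₂⁻¹ = D₂M₂ᵀD₂⁻¹ ∈ H₂`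
("if `h h₁ h₂⁻¹ = 1` … then `h₁ᵀh₁ = h₂ᵀh₂`"), and comparing diagonal entries
(`signDiag_of_diag_entries_eq`, the printed upper-left-entry argument iterated over the columns)
shows `M₁`, `M₂` are `±1`-diagonal; hence `h₁, h₂ ∈ K` and `a = (h₁h₂)⁻¹ = h₂h₁ ∈ K`.
[cite: BlasiakCohnGrochowPrattUmans2023, Thm. 4.10] -/
theorem BCGPU2023_thm410_holds : BCGPU2023_thm410 := by
  intro n
  classical
  -- the diagonal conjugators
  set x : Fin n → ℝ := fun i => ((2 : ℝ) ^ (i : ℕ))⁻¹ with hx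
  set y : Fin n → ℝ := fun i => (2 : ℝ) ^ (i : ℕ) with hy
  have hx0 : ∀ i, 0 < x i := fun i => by positivity
  have hy0 : ∀ i, 0 < y i := fun i => by positivity
  have hymono : StrictMono y := fun i j hij =>
    pow_lt_pow_right₀ (by norm_num : (1 : ℝ) < 2) (Fin.lt_def.1 hij)
  have hxanti : StrictAnti x := fun i j hij =>
    (inv_lt_inv₀ (hy0 j) (hy0 i)).2 (hymono hij)
  have hdx : Matrix.diagonal x * Matrix.diagonal (fun i => (x i)⁻¹) = 1 := by
    rw [Matrix.diagonal_mul_diagonal, ← Matrix.diagonal_one]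
    congr 1
    funext i
    exact mul_inv_cancel₀ (hx0 i).ne'
  have hdx' : Matrix.diagonal (fun i => (x i)⁻¹) * Matrix.diagonal x = 1 := by
    rw [Matrix.diagonal_mul_diagonal, ← Matrix.diagonal_one]
    congr 1
    funext i
    exact inv_mul_cancel₀ (hx0 i).ne'
  have hdy : Matrix.diagonal y * Matrix.diagonal (fun i => (y i)⁻¹) = 1 := by
    rw [Matrix.diagonal_mul_diagonal, ← Matrix.diagonal_one]
    congr 1
    funext i
    exact mul_inv_cancel₀ (hy0 i).ne'
  have hdy' : Matrix.diagonal (fun i => (y i)⁻¹) * Matrix.diagonal y = 1 := by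
    rw [Matrix.diagonal_mul_diagonal, ← Matrix.diagonal_one]
    congr 1
    funext i
    exact inv_mul_cancel₀ (hy0 i).ne'
  set g₁ : GL (Fin n) ℝ := ⟨Matrix.diagonal x, Matrix.diagonal fun i => (x i)⁻¹, hdx, hdx'⟩ with hg₁
  set g₂ : GL (Fin n) ℝ := ⟨Matrix.diagonal y, Matrix.diagonal fun i => (y i)⁻¹, hdy, hdy'⟩ with hg₂
  have hg₁v : ((g₁ : GL (Fin n) ℝ) : Matrix (Fin n) (Fin n) ℝ) = Matrix.diagonal x := rfl
  have hg₁i : ((g₁⁻¹ : GL (Fin n) ℝ) : Matrix (Fin n) (Fin n) ℝ) = Matrix.diagonal fun i => (x i)⁻¹ :=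
    rfl
  have hg₂v : ((g₂ : GL (Fin n) ℝ) : Matrix (Fin n) (Fin n) ℝ) = Matrix.diagonal y := rfl
  have hg₂i : ((g₂⁻¹ : GL (Fin n) ℝ) : Matrix (Fin n) (Fin n) ℝ) = Matrix.diagonal fun i => (y i)⁻¹ :=
    rfl
  refine ⟨g₁, g₂, ?_⟩
  rintro a ha _ ⟨M₁, hM₁, rfl⟩ _ ⟨N, hN, rfl⟩ habc
  have habc' : a * (g₁ * M₁ * g₁⁻¹) * (g₂ * N * g₂⁻¹) = 1 := habc
  have ha' : ((a : GL (Fin n) ℝ) : Matrix (Fin n) (Fin n) ℝ)ᵀ * (a : Matrix (Fin n) (Fin n) ℝ) = 1 := ha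
  have hM₁' : ((M₁ : GL (Fin n) ℝ) : Matrix (Fin n) (Fin n) ℝ)ᵀ * (M₁ : Matrix (Fin n) (Fin n) ℝ) = 1 :=
    hM₁
  have hN' : ((N : GL (Fin n) ℝ) : Matrix (Fin n) (Fin n) ℝ)ᵀ * (N : Matrix (Fin n) (Fin n) ℝ) = 1 := hN
  -- the matrix of `N⁻¹` is `Nᵀ`
  have hNinv : ((N⁻¹ : GL (Fin n) ℝ) : Matrix (Fin n) (Fin n) ℝ) = (N : Matrix (Fin n) (Fin n) ℝ)ᵀ := by
    have h1 : ((N⁻¹ : GL (Fin n) ℝ) : Matrix (Fin n) (Fin n) ℝ) * (N : Matrix (Fin n) (Fin n) ℝ) = 1 := by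
      rw [← Units.val_mul, inv_mul_cancel, Units.val_one]
    have h2 : (N : Matrix (Fin n) (Fin n) ℝ) * (N : Matrix (Fin n) (Fin n) ℝ)ᵀ = 1 :=
      mul_eq_one_comm.1 hN'
    calc ((N⁻¹ : GL (Fin n) ℝ) : Matrix (Fin n) (Fin n) ℝ)
        = (N⁻¹ : GL (Fin n) ℝ) * ((N : Matrix (Fin n) (Fin n) ℝ) * (N : Matrix (Fin n) (Fin n) ℝ)ᵀ) := by
          rw [h2, Matrix.mul_one]
      _ = (N : Matrix (Fin n) (Fin n) ℝ)ᵀ := by rw [← Matrix.mul_assoc, h1, Matrix.one_mul]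
  -- matrices of `h₁ = g₁ M₁ g₁⁻¹`, `h₂ = g₂ N g₂⁻¹` and `h₂⁻¹ = g₂ N⁻¹ g₂⁻¹`
  set B := Matrix.diagonal x * (M₁ : Matrix (Fin n) (Fin n) ℝ) * Matrix.diagonal (fun i => (x i)⁻¹)
    with hB
  set Cm := Matrix.diagonal y * (N : Matrix (Fin n) (Fin n) ℝ) * Matrix.diagonal (fun i => (y i)⁻¹)
    with hCm
  set C' := Matrix.diagonal y * (N : Matrix (Fin n) (Fin n) ℝ)ᵀ * Matrix.diagonal (fun i => (y i)⁻¹)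
    with hC'
  have hbm : ((g₁ * M₁ * g₁⁻¹ : GL (Fin n) ℝ) : Matrix (Fin n) (Fin n) ℝ) = B := by
    rw [Units.val_mul, Units.val_mul, hg₁v, hg₁i]
  have hcm : ((g₂ * N * g₂⁻¹ : GL (Fin n) ℝ) : Matrix (Fin n) (Fin n) ℝ) = Cm := by
    rw [Units.val_mul, Units.val_mul, hg₂v, hg₂i]
  have hcm' : ((g₂ * N⁻¹ * g₂⁻¹ : GL (Fin n) ℝ) : Matrix (Fin n) (Fin n) ℝ) = C' := by
    rw [Units.val_mul, Units.val_mul, hg₂v, hg₂i, hNinv]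
  have hBentry : ∀ i k, B i k = x i * (M₁ : Matrix (Fin n) (Fin n) ℝ) i k * (x k)⁻¹ := by
    intro i k
    rw [hB, Matrix.mul_diagonal, Matrix.diagonal_mul]
  have hCmentry : ∀ i k, Cm i k = y i * (N : Matrix (Fin n) (Fin n) ℝ) i k * (y k)⁻¹ := by
    intro i k
    rw [hCm, Matrix.mul_diagonal, Matrix.diagonal_mul]
  have hC'entry : ∀ i k, C' i k = y i * (N : Matrix (Fin n) (Fin n) ℝ)ᵀ i k * (y k)⁻¹ := by
    intro i k
    rw [hC', Matrix.mul_diagonal, Matrix.diagonal_mul]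
  -- `a h₁ = h₂⁻¹`, so `h₁ᵀ h₁ = (h₂⁻¹)ᵀ (h₂⁻¹)`
  have hab : a * (g₁ * M₁ * g₁⁻¹) = g₂ * N⁻¹ * g₂⁻¹ := by
    rw [eq_inv_of_mul_eq_one_left habc']
    simp only [mul_inv_rev, inv_inv, mul_assoc]
  have hAB : (a : Matrix (Fin n) (Fin n) ℝ) * B = C' := by
    have h := congrArg (fun g : GL (Fin n) ℝ => (g : Matrix (Fin n) (Fin n) ℝ)) hab
    rw [Units.val_mul, hbm, hcm'] at h
    exact h
  have hBB : Bᵀ * B = C'ᵀ * C' := by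
    calc Bᵀ * B = Bᵀ * (((a : GL (Fin n) ℝ) : Matrix (Fin n) (Fin n) ℝ)ᵀ *
          (a : Matrix (Fin n) (Fin n) ℝ)) * B := by rw [ha', Matrix.mul_one]
      _ = ((a : Matrix (Fin n) (Fin n) ℝ) * B)ᵀ * ((a : Matrix (Fin n) (Fin n) ℝ) * B) := by
          rw [Matrix.transpose_mul (a : Matrix (Fin n) (Fin n) ℝ) B]; simp only [Matrix.mul_assoc]
      _ = C'ᵀ * C' := by rw [hAB]
  have hPQ : ∀ k, ∑ i, (x i * (M₁ : Matrix (Fin n) (Fin n) ℝ) i k * (x k)⁻¹) ^ 2 =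
      ∑ i, (y i * (N : Matrix (Fin n) (Fin n) ℝ)ᵀ i k * (y k)⁻¹) ^ 2 := by
    intro k
    have h := congrFun (congrFun hBB k) k
    simp only [Matrix.mul_apply, Matrix.transpose_apply B, Matrix.transpose_apply C', hBentry,
      hC'entry] at h
    simpa only [pow_two] using h
  -- the core lemma: `M₁` and `Nᵀ` are `±1`-diagonal
  have hNt : ((N : Matrix (Fin n) (Fin n) ℝ)ᵀ)ᵀ * (N : Matrix (Fin n) (Fin n) ℝ)ᵀ = 1 := by
    rw [Matrix.transpose_transpose]; exact mul_eq_one_comm.1 hN'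
  have core := signDiag_of_diag_entries_eq _ _ hM₁' hNt x y hx0 hxanti hy0 hymono hPQ
  -- `h₁ ∈ K` and `h₂ ∈ K`
  have hBK : ∀ j l, (j ≠ l → B j l = 0) ∧ (B j j = 1 ∨ B j j = -1) := by
    intro j l
    refine ⟨fun hjl => ?_, ?_⟩
    · rw [hBentry, ((core l).1 j hjl).1, mul_zero, zero_mul]
    · rw [hBentry, mul_assoc, mul_comm ((M₁ : Matrix (Fin n) (Fin n) ℝ) j j), ← mul_assoc,
        mul_inv_cancel₀ (hx0 j).ne', one_mul]
      exact (core j).2.1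
  have hCK : ∀ j l, (j ≠ l → Cm j l = 0) ∧ (Cm j j = 1 ∨ Cm j j = -1) := by
    intro j l
    refine ⟨fun hjl => ?_, ?_⟩
    · have h0 : (N : Matrix (Fin n) (Fin n) ℝ) j l = 0 := by
        have h := ((core j).1 l (Ne.symm hjl)).2
        rwa [Matrix.transpose_apply] at h
      rw [hCmentry, h0, mul_zero, zero_mul]
    · rw [hCmentry, mul_assoc, mul_comm ((N : Matrix (Fin n) (Fin n) ℝ) j j), ← mul_assoc,
        mul_inv_cancel₀ (hy0 j).ne', one_mul]
      have h := (core j).2.2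
      rwa [Matrix.transpose_apply] at h
  -- `a = h₂ h₁` (as `a h₁ h₂ = 1` and `h₁² = h₂² = 1`)
  have habcm : (a : Matrix (Fin n) (Fin n) ℝ) * B * Cm = 1 := by
    have h := congrArg (fun g : GL (Fin n) ℝ => (g : Matrix (Fin n) (Fin n) ℝ)) habc'
    rw [Units.val_mul, Units.val_mul, hbm, hcm, Units.val_one] at h
    exact h
  have haCB : (a : Matrix (Fin n) (Fin n) ℝ) = Cm * B := by
    calc (a : Matrix (Fin n) (Fin n) ℝ) = (a : Matrix (Fin n) (Fin n) ℝ) * (B * (Cm * Cm) * B) := by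
          rw [signDiag_mul_self hCK, Matrix.mul_one, signDiag_mul_self hBK, Matrix.mul_one]
      _ = (a : Matrix (Fin n) (Fin n) ℝ) * B * Cm * (Cm * B) := by simp only [Matrix.mul_assoc]
      _ = Cm * B := by rw [habcm, Matrix.one_mul]
  refine ⟨?_, ?_, ?_⟩
  · show ∀ j l : Fin n, (j ≠ l → (a : Matrix (Fin n) (Fin n) ℝ) j l = 0) ∧
      ((a : Matrix (Fin n) (Fin n) ℝ) j j = 1 ∨ (a : Matrix (Fin n) (Fin n) ℝ) j j = -1)
    rw [haCB]
    exact signDiag_mul hCK hBK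
  · show ∀ j l : Fin n, (j ≠ l → ((g₁ * M₁ * g₁⁻¹ : GL (Fin n) ℝ) : Matrix (Fin n) (Fin n) ℝ) j l = 0) ∧
      (((g₁ * M₁ * g₁⁻¹ : GL (Fin n) ℝ) : Matrix (Fin n) (Fin n) ℝ) j j = 1 ∨
        ((g₁ * M₁ * g₁⁻¹ : GL (Fin n) ℝ) : Matrix (Fin n) (Fin n) ℝ) j j = -1)
    rw [hbm]
    exact hBK
  · show ∀ j l : Fin n, (j ≠ l → ((g₂ * N * g₂⁻¹ : GL (Fin n) ℝ) : Matrix (Fin n) (Fin n) ℝ) j l = 0) ∧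
      (((g₂ * N * g₂⁻¹ : GL (Fin n) ℝ) : Matrix (Fin n) (Fin n) ℝ) j j = 1 ∨
        ((g₂ * N * g₂⁻¹ : GL (Fin n) ℝ) : Matrix (Fin n) (Fin n) ℝ) j j = -1)
    rw [hcm]
    exact hCK

end Thm410Proof

end Literature.Computability.AlgebraicComplexity
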